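import Literature.Computability.MetaComplexity.BoundedArithSymbols
import HarnessLib

/-!
# Models of the universal theory of the expansions: transfer, `BASIC`, the `χ`-bridge and fact schemas

Topic `Literature/Computability/MetaComplexity` (continuation of `BoundedArithSymbols.lean`).  We
study an arbitrary model `K` of the universal theory `QSym.univTheory k` of the canonical
expansions of the models of `T₂ᵏ⁺¹` (the structure `K` of the Herbrand-saturation route to
Buss's conservation theorem, `Literature/Computability/Complexity/BoundedArithmeticHerbrand.lean`).
Every result here is *proved*, by one pattern: a universal `Language.qsym k`-sentence is verified
in the expansion of every model of `BASIC + Σᵇ₁-IND + Σᵇₖ₊₁-IND` (where the symbols have their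
intended interpretations `chiFn`, `muFn`, `lsearchFn`, `histFn`, …) and transferred to `K`.

## Main statements

* `QSym.realize_of_fact` — **transfer**: a universal formula true in all expansions under all
  assignments is true in `K` under all assignments; `QSym.realize_sentence_of_fact` (sentences
  of Buss's language); `isUniversal_of_mem_BASIC`, `QSym.model_BASIC_of_model_univTheory` —
  **`K ⊨ BASIC`** on a compatible reduct (so the algebraic façade of `BoundedArithAlgebra` is
  available in `K`);
* **the `χ`-bridge** `QSym.realize_iff_chi_eq_one`: for every `Σᵇₖ₊₁ ∪ Πᵇₖ₊₁` formula `θ`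
  (context variables) and its characteristic symbol, `θ(x̄) ↔ χ_θ(x̄) = 1` in `K` (induction on
  the class with motive `QSym.ChiEquiv`, through `chiEquiv_of_isQF/imp/not/bexLE/ballLE/
  ballLELen/bexLELen`, `chiEquiv_of_isSharplyBounded`, `chiEquiv_of_isSigmab_and_of_isPib`);
* **fact schemas** used by the bridge and by the later files: `realize_iff_chi_of_isQF`,
  `chi_imp_iff`, `mu_witness` (the least-witness symbol finds a witness, Buss 1990 Thm. 12),
  `chi_bexLE_iff`, `chi_ballLE_iff`, `lsearch_le_of_eq_zero`, `eq_zero_of_lsearch_le`,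
  `chi_ballLELen_iff`, `chi_bexLELen_iff`, `chi_eq_zero_or_one`, `chi_ne_one_iff`;
  `selV_spec` (definition by cases), `app_termSym` (every term is a symbol), `monus_spec`,
  `msp_spec`, `msp_le`, `itv_zero` / `itv_succ` (the iterates of a symbol, Buss 1990
  Thm. 11(b)), `seqel_hist` / `hist_le` (decoding and size of the code of an iteration);
* helpers: `app`, `qapp`, `qv`, `ιt`, `qone`, `chiTerm`, `muTerm`, `lsTerm`, `histSTerm`,
  `histWTerm`, `realize_qle` / `realize_qle_expansion`, `realize_snoc_terms`, `realize_func_vec4`,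
  `funMap_expansion`, `funMap_ba`, `IsUniversal.onBoundedFormula`.

The setting: `K` carries structures for both languages with `qsymι k` an expansion on `K` (for
a bare `Language.qsym k`-structure, its reduct).

## References

* S. R. Buss, *Axiomatizations and conservation results for fragments of bounded arithmetic*,
  Contemp. Math. 106, AMS 1990, §3, Thm. 11(b), Thm. 12.
* J. Krajíček, *Bounded Arithmetic, Propositional Logic and Complexity Theory*, CUP 1995, §5.3,
  §7.6 (the universal theories `PVᵢ` and their models).
* S. R. Buss, *Bounded Arithmetic*, Bibliopolis 1986, §2.2 (`BASIC` is a set of universal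
  closures of open formulas).
-/

namespace Literature.Computability.MetaComplexity

open FirstOrder FirstOrder.Language FirstOrder.Language.BoundedFormula

/-! ## Language maps preserve open and universal formulas -/

section LHom

variable {L L' : Language} {α : Type} {n : ℕ}

/-- A language map sends quantifier-free formulas to quantifier-free formulas (a private copy of
`IsQF.onBoundedFormula` of `Literature/Analysis/FunctionSpaces/PVTheory.lean`, to keep the import
graph small). [folklore] -/
private theorem isQF_onBoundedFormula (g : L →ᴸ L')
    {φ : L.BoundedFormula α n} (h : φ.IsQF) : (g.onBoundedFormula φ).IsQF := by
  induction h with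
  | falsum => exact IsQF.falsum
  | of_isAtomic h =>
    cases h with
    | equal t₁ t₂ => exact (IsAtomic.equal _ _).isQF
    | rel R ts => exact (IsAtomic.rel _ _).isQF
  | imp _ _ ih₁ ih₂ => exact ih₁.imp ih₂

/-- A language map sends universal formulas to universal formulas. [folklore] -/
theorem _root_.FirstOrder.Language.BoundedFormula.IsUniversal.onBoundedFormula (g : L →ᴸ L')
    {φ : L.BoundedFormula α n} (h : φ.IsUniversal) : (g.onBoundedFormula φ).IsUniversal := by
  induction h with
  | of_isQF h => exact (isQF_onBoundedFormula g h).isUniversal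
  | all _ ih => exact ih.all

end LHom

/-! ## The axioms of `BASIC` are universal sentences -/

/-- Every axiom of `BASIC` is a universal sentence: each is the universal closure of an open
formula (Buss 1986, §2.2). [cite: Buss1986, §2.2] -/
theorem isUniversal_of_mem_BASIC {φ : Language.boundedArith.Sentence} (hφ : φ ∈ BASIC) :
    φ.IsUniversal := by
  have key : ∀ ψ ∈ basicAxioms, BoundedFormula.IsUniversal ψ := by
    simp only [basicAxioms, List.forall_mem_cons]
    and_intros
    all_goals
      first
        | (intro x hx; simp at hx)
        | (refine BoundedFormula.IsQF.isUniversal_alls ?_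
           repeat'
             first
               | exact IsQF.falsum
               | exact (IsAtomic.equal _ _).isQF
               | exact (IsAtomic.rel _ _).isQF
               | refine IsQF.imp ?_ ?_)
  exact key φ hφ

namespace QSym

open BASICModel

variable {k : ℕ}

/-! ## The setting: a structure for both languages, `qsymι` an expansion -/

/- Throughout, `K` carries a `Language.boundedArith`-structure and a `Language.qsym k`-structure
along which `qsymι k` is an expansion (for a bare `Language.qsym k`-structure take the reduct
`(qsymι k).reduct K`, an expansion by `LHom.isExpansionOn_reduct`). -/

variable {K : Type} [Language.boundedArith.Structure K] [(Language.qsym k).Structure K]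
  [(qsymι k).IsExpansionOn K]

/-! ## Transfer of universal facts -/

omit [Language.boundedArith.Structure K] [(qsymι k).IsExpansionOn K] in
/-- **Transfer.** A universal `Language.qsym k`-formula (in-context variables, no parameters)
which holds in the expansion of every model of `BASIC + Σᵇ₁-IND + Σᵇₖ₊₁-IND` under every
assignment holds in every model `K` of `univTheory k` under every assignment: its universal
closure belongs to `univTheory k`. [folklore] -/
theorem realize_of_fact (hK : K ⊨ univTheory k) {n : ℕ}
    {ψ : (Language.qsym k).BoundedFormula Empty n} (hψ : ψ.IsUniversal)
    (h : ∀ (N : Type) [Language.boundedArith.Structure N] [N ⊨ BASIC]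
      [N ⊨ INDScheme (sigmabFormulas 1)], N ⊨ INDScheme (sigmabFormulas (k + 1)) →
        ∀ xs : Fin n → N, @BoundedFormula.Realize _ N (expansion N k) _ _ ψ default xs)
    (xs : Fin n → K) : ψ.Realize default xs := by
  have hmem : ψ.alls ∈ univTheory k := by
    refine mem_univTheory hψ.alls fun N _ _ _ hIk => ?_
    letI := expansion N k
    simp only [Sentence.Realize, realize_alls]
    exact fun xs => h N hIk xs
  have hKs : K ⊨ ψ.alls := hK.realize_of_mem _ hmem
  simp only [Sentence.Realize, realize_alls] at hKs
  exact hKs xs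

/-- Transfer for sentences of Buss's language: a universal `Language.boundedArith`-sentence true
in every model of `BASIC + Σᵇ₁-IND + Σᵇₖ₊₁-IND` holds in (the reduct of) every model of
`univTheory k`. [folklore] -/
theorem realize_sentence_of_fact (hK : K ⊨ univTheory k) {σ : Language.boundedArith.Sentence}
    (hσ : σ.IsUniversal)
    (h : ∀ (N : Type) [Language.boundedArith.Structure N] [N ⊨ BASIC]
      [N ⊨ INDScheme (sigmabFormulas 1)], N ⊨ INDScheme (sigmabFormulas (k + 1)) → N ⊨ σ) :
    K ⊨ σ := by
  have hmem : (qsymι k).onSentence σ ∈ univTheory k := by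
    refine mem_univTheory (hσ.onBoundedFormula _) fun N _ _ _ hIk => ?_
    letI := expansion N k
    haveI : (qsymι k).IsExpansionOn N := isExpansionOn_expansion k
    exact (LHom.realize_onSentence N (qsymι k) σ).2 (h N hIk)
  exact (LHom.realize_onSentence K (qsymι k) σ).1 (hK.realize_of_mem _ hmem)

/-- **A model of `univTheory k` is a model of `BASIC`** (on its reduct to Buss's language).
[cite: Buss1986, §2.2] -/
theorem model_BASIC_of_model_univTheory (hK : K ⊨ univTheory k) : K ⊨ BASIC :=
  ⟨fun _ hσ => realize_sentence_of_fact hK (isUniversal_of_mem_BASIC hσ) fun _ _ _ _ _ =>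
    Theory.realize_sentence_of_mem BASIC hσ⟩


/-! ## Terms and evaluation conventions -/

section Terms

variable {n : ℕ}

/-- A symbol applied to a tuple, in a `Language.qsym k`-structure. [folklore] -/
abbrev app (s : QSym k n) (v : Fin n → K) : K := Structure.funMap (L := Language.qsym k) s v

/-- The term `s(x₀, …, x_{m-1})`: a symbol applied to terms. [folklore] -/
abbrev qapp {m : ℕ} {α : Type} (s : QSym k m) (ts : Fin m → (Language.qsym k).Term α) :
    (Language.qsym k).Term α :=
  Term.func s ts

/-- The `i`-th in-context variable as a `Language.qsym k`-term. [folklore] -/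
abbrev qv (i : Fin n) : (Language.qsym k).Term (Empty ⊕ Fin n) := Term.var (Sum.inr i)

/-- A term of Buss's language as a `Language.qsym k`-term. [folklore] -/
abbrev ιt {α : Type} (t : Language.boundedArith.Term α) : (Language.qsym k).Term α :=
  (qsymι k).onTerm t

/-- The numeral `1` as a `Language.qsym k`-term. [folklore] -/
abbrev qone {α : Type} : (Language.qsym k).Term α := ιt (natConst 1)

/-- The term `χ_θ(x₀, …, x_{n-1})`. [folklore] -/
abbrev chiTerm (θ : Language.boundedArith.BoundedFormula Empty n)
    (h : IsSigmab (k + 1) θ ∨ IsPib (k + 1) θ) : (Language.qsym k).Term (Empty ⊕ Fin n) :=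
  qapp (chi θ h) fun i => qv i

omit [(qsymι k).IsExpansionOn K] in
/-- In the expansion of `N`, symbols are interpreted by `eval`. [folklore] -/
@[simp] theorem funMap_expansion {N : Type} [Language.boundedArith.Structure N] [N ⊨ BASIC]
    [N ⊨ INDScheme (sigmabFormulas 1)] (s : QSym k n) (v : Fin n → N) :
    @Structure.funMap _ N (expansion N k) _ s v = eval s v := rfl

/-- In `K`, the numeral `1` denotes `1`. [folklore] -/
@[simp] theorem realize_qone [K ⊨ BASIC] {α : Type} (v : α → K) :
    (qone : (Language.qsym k).Term α).realize v = 1 := by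
  rw [qone, ιt, LHom.realize_onTerm]
  simp

/-- In `K`, a term of Buss's language denotes what it denotes in the reduct. [folklore] -/
@[simp] theorem realize_ιt {α : Type} (t : Language.boundedArith.Term α) (v : α → K) :
    (ιt t : (Language.qsym k).Term α).realize v = t.realize v :=
  LHom.realize_onTerm _ _ _

omit [Language.boundedArith.Structure K] [(Language.qsym k).Structure K] [(qsymι k).IsExpansionOn K] in
/-- Realizing a `Fin.snoc` tuple of terms. [folklore] -/
theorem realize_snoc_terms {L : Language} {P : Type} [L.Structure P] {α : Type} {m : ℕ}
    (w : α → P) (ts : Fin m → L.Term α) (t : L.Term α) :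
    (fun i => (Fin.snoc (α := fun _ => L.Term α) ts t i).realize w) =
      Fin.snoc (α := fun _ => P) (fun i => (ts i).realize w) (t.realize w) := by
  funext i
  cases i using Fin.lastCases with
  | last => simp
  | cast i => simp

omit [Language.boundedArith.Structure K] [(Language.qsym k).Structure K] [(qsymι k).IsExpansionOn K] in
/-- `(x₀,…,x_{n-1}, x_n)` reassembled from its parts. [folklore] -/
@[simp] theorem snoc_castSucc_last {P : Type} {m : ℕ} (u : Fin (m + 1) → P) :
    (Fin.snoc (fun i => u (Fin.castSucc i)) (u (Fin.last m)) : Fin (m + 1) → P) = u :=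
  Fin.snoc_init_self u

omit [Language.boundedArith.Structure K] [(Language.qsym k).Structure K] [(qsymι k).IsExpansionOn K] in
/-- `(x̄, a, b)` restricted to its first block is `x̄`. [folklore] -/
@[simp] theorem snoc_snoc_comp_castSucc_castSucc {P : Type} {m : ℕ} (x : Fin m → P) (a b : P) :
    (Fin.snoc (Fin.snoc x a : Fin (m + 1) → P) b : Fin (m + 2) → P) ∘ (Fin.castSucc ∘ Fin.castSucc) = x := by
  funext i; simp

omit [Language.boundedArith.Structure K] [(Language.qsym k).Structure K] [(qsymι k).IsExpansionOn K] in
/-- Realizing a symbol applied to four terms. [folklore] -/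
@[simp] theorem realize_func_vec4 {L' : Language} {P : Type} [L'.Structure P] {α : Type}
    (f : L'.Functions 4) (a b c d : L'.Term α) (w : α → P) :
    (Term.func f ![a, b, c, d]).realize w =
      Structure.funMap f ![a.realize w, b.realize w, c.realize w, d.realize w] := by
  rw [Term.realize]
  congr 1
  funext i
  fin_cases i <;> rfl

end Terms

/-! ## First facts: characteristic functions of open formulas and of implications -/

section ChiFacts

variable {n : ℕ} [hKB : K ⊨ BASIC]

/-- **Fact (χ of an open formula).** In a model of `univTheory k`, for an open `θ`:
`θ(x̄) ↔ χ_θ(x̄) = 1`. [folklore] -/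
theorem realize_iff_chi_of_isQF (hK : K ⊨ univTheory k)
    {θ : Language.boundedArith.BoundedFormula Empty n} (hθ : θ.IsQF)
    (h : IsSigmab (k + 1) θ ∨ IsPib (k + 1) θ) (xs : Fin n → K) :
    θ.Realize default xs ↔ app (chi θ h) xs = 1 := by
  -- the universal fact `ι θ ⇔ (χ_θ(x̄) = 1)`
  let ψ : (Language.qsym k).BoundedFormula Empty n :=
    ((qsymι k).onBoundedFormula θ).iff (Term.bdEqual (chiTerm θ h) qone)
  have hψ : ψ.IsUniversal := by
    have h1 : ((qsymι k).onBoundedFormula θ).IsQF := isQF_onBoundedFormula _ hθ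
    have h2 : (Term.bdEqual (chiTerm θ h) qone : (Language.qsym k).BoundedFormula Empty n).IsQF :=
      (IsAtomic.equal _ _).isQF
    exact ((h1.imp h2).inf (h2.imp h1)).isUniversal
  have hfact := realize_of_fact hK hψ (fun N _ _ _ hIk xs => by
    letI := expansion N k
    haveI : (qsymι k).IsExpansionOn N := isExpansionOn_expansion k
    simp only [ψ, realize_iff, LHom.realize_onBoundedFormula, realize_bdEqual, Term.realize,
      funMap_expansion, eval_chi, Sum.elim_inr, LHom.realize_onTerm, realize_natConst_one, mSucc_eq,
      mZero_eq, zero_add, chiFn_eq_one_iff]) xs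
  simp only [ψ, realize_iff, LHom.realize_onBoundedFormula, realize_bdEqual, Term.realize,
    Sum.elim_inr, realize_qone] at hfact
  exact hfact

end ChiFacts


/-! ## Semantics of `≤` for `Language.qsym k`-terms -/

section Le

variable {m : ℕ} {α : Type}

omit [(qsymι k).IsExpansionOn K] [(Language.qsym k).Structure K] in
/-- In the expansion of `N`, an atomic inequality of `Language.qsym k`-terms means `≤`. [folklore] -/
@[simp] theorem realize_qle_expansion {N : Type} [Language.boundedArith.Structure N] [N ⊨ BASIC]
    [N ⊨ INDScheme (sigmabFormulas 1)] (s₁ s₂ : (Language.qsym k).Term (α ⊕ Fin m))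
    (w : α → N) (xs : Fin m → N) :
    @BoundedFormula.Realize _ N (expansion N k) _ _ (Term.le s₁ s₂) w xs ↔
      @Term.realize _ N (expansion N k) _ (Sum.elim w xs) s₁ ≤
        @Term.realize _ N (expansion N k) _ (Sum.elim w xs) s₂ := by
  letI := expansion N k
  rw [Term.le, realize_rel₂]
  exact mLe_iff _ _

/-- In `K`, an atomic inequality of `Language.qsym k`-terms means `≤` (of the reduct). [folklore] -/
@[simp] theorem realize_qle [K ⊨ BASIC] (s₁ s₂ : (Language.qsym k).Term (α ⊕ Fin m)) (w : α → K)
    (xs : Fin m → K) :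
    (Term.le s₁ s₂ : (Language.qsym k).BoundedFormula α m).Realize w xs ↔
      s₁.realize (Sum.elim w xs) ≤ s₂.realize (Sum.elim w xs) := by
  rw [Term.le, realize_rel₂]
  have h := LHom.IsExpansionOn.map_onRelation (ϕ := qsymι k) (M := K) BoundedArithRel.le
    ![s₁.realize (Sum.elim w xs), s₂.realize (Sum.elim w xs)]
  exact (Iff.of_eq h).trans (mLe_iff _ _)

end Le

/-! ## Facts: implication, least witness below a term, bounded quantifiers -/

section ClassFacts

variable {n : ℕ} [hKB : K ⊨ BASIC]

/-- **Fact (χ of an implication).** `χ_{φ→ψ}(x̄) = 1 ↔ (χ_φ(x̄) = 1 → χ_ψ(x̄) = 1)`. [folklore] -/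
theorem chi_imp_iff (hK : K ⊨ univTheory k) {φ ψ : Language.boundedArith.BoundedFormula Empty n}
    (hθ : IsSigmab (k + 1) (φ.imp ψ) ∨ IsPib (k + 1) (φ.imp ψ))
    (hφ : IsSigmab (k + 1) φ ∨ IsPib (k + 1) φ) (hψ : IsSigmab (k + 1) ψ ∨ IsPib (k + 1) ψ)
    (xs : Fin n → K) :
    app (chi (φ.imp ψ) hθ) xs = 1 ↔ (app (chi φ hφ) xs = 1 → app (chi ψ hψ) xs = 1) := by
  let Ψ : (Language.qsym k).BoundedFormula Empty n :=
    (Term.bdEqual (chiTerm (φ.imp ψ) hθ) qone).iff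
      ((Term.bdEqual (chiTerm φ hφ) qone).imp (Term.bdEqual (chiTerm ψ hψ) qone))
  have hΨ : Ψ.IsUniversal := by
    have h1 : (Term.bdEqual (chiTerm (φ.imp ψ) hθ) qone :
      (Language.qsym k).BoundedFormula Empty n).IsQF := (IsAtomic.equal _ _).isQF
    have h2 : ((Term.bdEqual (chiTerm φ hφ) qone).imp (Term.bdEqual (chiTerm ψ hψ) qone) :
      (Language.qsym k).BoundedFormula Empty n).IsQF :=
      (IsAtomic.equal _ _).isQF.imp (IsAtomic.equal _ _).isQF
    exact ((h1.imp h2).inf (h2.imp h1)).isUniversal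
  have hfact := realize_of_fact hK hΨ (fun N _ _ _ hIk xs => by
    letI := expansion N k
    haveI : (qsymι k).IsExpansionOn N := isExpansionOn_expansion k
    simp only [Ψ, realize_iff, realize_imp, realize_bdEqual, Term.realize, funMap_expansion,
      eval_chi, Sum.elim_inr, LHom.realize_onTerm, realize_natConst_one, mSucc_eq, mZero_eq, zero_add,
      chiFn_eq_one_iff]) xs
  simp only [Ψ, realize_iff, realize_imp, realize_bdEqual, Term.realize, Sum.elim_inr,
    realize_qone] at hfact
  exact hfact

variable {η : Language.boundedArith.BoundedFormula Empty (n + 1)}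
  {t : Language.boundedArith.Term (Empty ⊕ Fin n)}

/-- The term `μ_{η,t}(x̄)` in the context `(x̄, y)`. [folklore] -/
abbrev muTermUp (hη : IsSigmab (k + 1) η) (t : Language.boundedArith.Term (Empty ⊕ Fin n)) :
    (Language.qsym k).Term (Empty ⊕ Fin (n + 1)) :=
  qapp (mu η hη t) fun i => qv (Fin.castSucc i)

/-- The term `μ_{η,t}(x̄)` in the context `x̄`. [folklore] -/
abbrev muTerm (hη : IsSigmab (k + 1) η) (t : Language.boundedArith.Term (Empty ⊕ Fin n)) :
    (Language.qsym k).Term (Empty ⊕ Fin n) :=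
  qapp (mu η hη t) fun i => qv i

/-- **Fact (μ finds a witness).** If `χ_η(x̄, y) = 1` for some `y ≤ t(x̄)` then
`χ_η(x̄, μ(x̄)) = 1` and `μ(x̄) ≤ t(x̄)` (`μ = μ_{η,t}`). [folklore] -/
theorem mu_witness (hK : K ⊨ univTheory k) (hη : IsSigmab (k + 1) η)
    (hχ : IsSigmab (k + 1) η ∨ IsPib (k + 1) η) (xs : Fin n → K) {y : K}
    (hyt : y ≤ t.realize (Sum.elim default xs)) (hy : app (chi η hχ) (Fin.snoc xs y) = 1) :
    app (chi η hχ) (Fin.snoc xs (app (mu η hη t) xs)) = 1 ∧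
      app (mu η hη t) xs ≤ t.realize (Sum.elim default xs) := by
  -- variables of the context `(x̄, y)`
  let xv : Fin n → (Language.qsym k).Term (Empty ⊕ Fin (n + 1)) := fun i => qv (Fin.castSucc i)
  let yv : (Language.qsym k).Term (Empty ⊕ Fin (n + 1)) := qv (Fin.last n)
  let tup : (Language.qsym k).Term (Empty ⊕ Fin (n + 1)) := ιt (t.relabel (Sum.map id Fin.castSucc))
  let μx : (Language.qsym k).Term (Empty ⊕ Fin (n + 1)) := qapp (mu η hη t) xv
  let χy : (Language.qsym k).Term (Empty ⊕ Fin (n + 1)) := qapp (chi η hχ) (Fin.snoc xv yv)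
  let χμ : (Language.qsym k).Term (Empty ⊕ Fin (n + 1)) := qapp (chi η hχ) (Fin.snoc xv μx)
  let Ψ : (Language.qsym k).BoundedFormula Empty (n + 1) :=
    ((Term.bdEqual χy qone) ⊓ Term.le yv tup) ⟹ ((Term.bdEqual χμ qone) ⊓ Term.le μx tup)
  have hΨ : Ψ.IsUniversal :=
    (((IsAtomic.equal _ _).isQF.inf (IsAtomic.rel _ _).isQF).imp
      ((IsAtomic.equal _ _).isQF.inf (IsAtomic.rel _ _).isQF)).isUniversal
  have ev : ∀ {P : Type} (u : Fin (n + 1) → P),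
      (fun i => (Fin.snoc (fun i => u (Fin.castSucc i)) (u (Fin.last n)) : Fin (n + 1) → P) i) = u :=
    fun u => Fin.snoc_init_self u
  have hfact := realize_of_fact hK hΨ (fun N _ _ _ hIk u => by
    letI := expansion N k
    haveI : (qsymι k).IsExpansionOn N := isExpansionOn_expansion k
    simp only [Ψ, χy, χμ, μx, xv, yv, tup, realize_imp, realize_inf, realize_bdEqual,
      realize_qle_expansion, Term.realize, realize_snoc_terms, funMap_expansion, eval_chi, eval_mu,
      Sum.elim_inr, snoc_castSucc_last, Term.realize_relabel, Sum.elim_comp_map,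
      LHom.realize_onTerm, realize_natConst_one, mSucc_eq, mZero_eq, zero_add, chiFn_eq_one_iff]
    rintro ⟨hθy, hyt⟩
    have hyt' : u (Fin.last n) ≤ t.realize (Sum.elim default fun i => u (Fin.castSucc i)) := by
      simpa [Function.comp_def] using hyt
    have hθ' : η.Realize default (Fin.snoc (fun i => u (Fin.castSucc i)) (u (Fin.last n))) := by
      rw [snoc_castSucc_last]; exact hθy
    refine ⟨θ_muFn hIk hη.isSigmabDef_realize (muFn_le_t hIk hη.isSigmabDef_realize hyt' hθ'), ?_⟩
    simpa [Function.comp_def] using muFn_le_t hIk hη.isSigmabDef_realize hyt' hθ') (Fin.snoc xs y)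
  simp only [Ψ, χy, χμ, μx, xv, yv, tup, realize_imp, realize_inf, realize_bdEqual, realize_qle,
    Term.realize, realize_snoc_terms, Sum.elim_inr, Fin.snoc_castSucc, Fin.snoc_last, realize_ιt,
    Term.realize_relabel, Sum.elim_comp_map, realize_natConst_one, mSucc_eq, mZero_eq, zero_add] at hfact
  simp only [Function.comp_def, Fin.snoc_castSucc] at hfact
  exact hfact ⟨hy, hyt⟩

/-- **Fact (χ of a bounded existential).** For `θ = ∃ y ≤ t, η`:
`χ_θ(x̄) = 1 ↔ (χ_η(x̄, μ(x̄)) = 1 ∧ μ(x̄) ≤ t(x̄))` with `μ = μ_{η,t}`. [folklore] -/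
theorem chi_bexLE_iff (hK : K ⊨ univTheory k) (hη : IsSigmab (k + 1) η)
    (hχ : IsSigmab (k + 1) η ∨ IsPib (k + 1) η)
    (hθ : IsSigmab (k + 1) (bexLE t η) ∨ IsPib (k + 1) (bexLE t η)) (xs : Fin n → K) :
    app (chi (bexLE t η) hθ) xs = 1 ↔
      (app (chi η hχ) (Fin.snoc xs (app (mu η hη t) xs)) = 1 ∧
        app (mu η hη t) xs ≤ t.realize (Sum.elim default xs)) := by
  let μx : (Language.qsym k).Term (Empty ⊕ Fin n) := muTerm hη t
  let χμ : (Language.qsym k).Term (Empty ⊕ Fin n) := qapp (chi η hχ) (Fin.snoc (fun i => qv i) μx)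
  let Ψ : (Language.qsym k).BoundedFormula Empty n :=
    (Term.bdEqual (chiTerm (bexLE t η) hθ) qone).iff ((Term.bdEqual χμ qone) ⊓ Term.le μx (ιt t))
  have hΨ : Ψ.IsUniversal := by
    have h1 : (Term.bdEqual (chiTerm (bexLE t η) hθ) qone :
      (Language.qsym k).BoundedFormula Empty n).IsQF := (IsAtomic.equal _ _).isQF
    have h2 : ((Term.bdEqual χμ qone) ⊓ Term.le μx (ιt t) :
      (Language.qsym k).BoundedFormula Empty n).IsQF :=
      (IsAtomic.equal _ _).isQF.inf (IsAtomic.rel _ _).isQF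
    exact ((h1.imp h2).inf (h2.imp h1)).isUniversal
  have hfact := realize_of_fact hK hΨ (fun N _ _ _ hIk u => by
    letI := expansion N k
    haveI : (qsymι k).IsExpansionOn N := isExpansionOn_expansion k
    simp only [Ψ, χμ, μx, realize_iff, realize_inf, realize_bdEqual, realize_qle_expansion,
      Term.realize, realize_snoc_terms, funMap_expansion, eval_chi, eval_mu, Sum.elim_inr,
      LHom.realize_onTerm, realize_natConst_one, mSucc_eq, mZero_eq, zero_add, chiFn_eq_one_iff,
      realize_bexLE', mLe_iff]
    have hD := hη.isSigmabDef_realize (M := N)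
    constructor
    · rintro ⟨a, ha, hθa⟩
      exact ⟨θ_muFn hIk hD (muFn_le_t hIk hD ha hθa), muFn_le_t hIk hD ha hθa⟩
    · rintro ⟨h1, h2⟩
      exact ⟨_, h2, h1⟩) xs
  simp only [Ψ, χμ, μx, realize_iff, realize_inf, realize_bdEqual, realize_qle, Term.realize,
    realize_snoc_terms, Sum.elim_inr, realize_ιt, realize_natConst_one, mSucc_eq, mZero_eq,
    zero_add] at hfact
  exact hfact

/-- **Fact (χ of a bounded universal).** For `θ = ∀ y ≤ t, η`, with the counterexample search
`c = μ_{¬η,t}`: `χ_θ(x̄) = 1 ↔ ¬(χ_{¬η}(x̄, c(x̄)) = 1 ∧ c(x̄) ≤ t(x̄))`. [folklore] -/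
theorem chi_ballLE_iff (hK : K ⊨ univTheory k) (hnη : IsSigmab (k + 1) (∼η))
    (hχ : IsSigmab (k + 1) (∼η) ∨ IsPib (k + 1) (∼η))
    (hθ : IsSigmab (k + 1) (ballLE t η) ∨ IsPib (k + 1) (ballLE t η)) (xs : Fin n → K) :
    app (chi (ballLE t η) hθ) xs = 1 ↔
      ¬(app (chi (∼η) hχ) (Fin.snoc xs (app (mu (∼η) hnη t) xs)) = 1 ∧
        app (mu (∼η) hnη t) xs ≤ t.realize (Sum.elim default xs)) := by
  let μx : (Language.qsym k).Term (Empty ⊕ Fin n) := muTerm hnη t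
  let χμ : (Language.qsym k).Term (Empty ⊕ Fin n) :=
    qapp (chi (∼η) hχ) (Fin.snoc (fun i => qv i) μx)
  let Ψ : (Language.qsym k).BoundedFormula Empty n :=
    (Term.bdEqual (chiTerm (ballLE t η) hθ) qone).iff (∼((Term.bdEqual χμ qone) ⊓ Term.le μx (ιt t)))
  have hΨ : Ψ.IsUniversal := by
    have h1 : (Term.bdEqual (chiTerm (ballLE t η) hθ) qone :
      (Language.qsym k).BoundedFormula Empty n).IsQF := (IsAtomic.equal _ _).isQF
    have h2 : (∼((Term.bdEqual χμ qone) ⊓ Term.le μx (ιt t)) :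
      (Language.qsym k).BoundedFormula Empty n).IsQF :=
      ((IsAtomic.equal _ _).isQF.inf (IsAtomic.rel _ _).isQF).not
    exact ((h1.imp h2).inf (h2.imp h1)).isUniversal
  have hfact := realize_of_fact hK hΨ (fun N _ _ _ hIk u => by
    letI := expansion N k
    haveI : (qsymι k).IsExpansionOn N := isExpansionOn_expansion k
    simp only [Ψ, χμ, μx, realize_iff, realize_inf, realize_not, realize_bdEqual,
      realize_qle_expansion, Term.realize, realize_snoc_terms, funMap_expansion, eval_chi, eval_mu,
      Sum.elim_inr, LHom.realize_onTerm, realize_natConst_one, mSucc_eq, mZero_eq, zero_add,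
      chiFn_eq_one_iff, realize_ballLE', mLe_iff]
    have hD : IsSigmabDef (k + 1) fun v : Fin (n + 1) → N => (∼η).Realize default v :=
      hnη.isSigmabDef_realize
    constructor
    · rintro hall ⟨h1, h2⟩
      exact h1 (hall _ h2)
    · intro hno a ha
      by_contra hθa
      have hθa' : (∼η).Realize default (Fin.snoc u a) := by simpa using hθa
      exact hno ⟨by simpa using θ_muFn hIk hD (muFn_le_t hIk hD ha hθa'),
        muFn_le_t hIk hD ha hθa'⟩) xs
  simp only [Ψ, χμ, μx, realize_iff, realize_inf, realize_not, realize_bdEqual, realize_qle,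
    Term.realize, realize_snoc_terms, Sum.elim_inr, realize_ιt, realize_natConst_one, mSucc_eq,
    mZero_eq, zero_add] at hfact
  exact hfact

variable {s : Language.boundedArith.Term (Empty ⊕ Fin n)}

/-- The term `ls(x̄)` for a least-zero symbol `ls = lsearch g s`. [folklore] -/
abbrev lsTerm (g : QSym k (n + 1)) (s : Language.boundedArith.Term (Empty ⊕ Fin n)) :
    (Language.qsym k).Term (Empty ⊕ Fin n) :=
  qapp (lsearch g s) fun i => qv i

/-- **Fact (least zero, minimality).** If `g(x̄, z) = 0` and `z ≤ |s(x̄)|` then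
`lsearch(x̄) ≤ z`. [folklore] -/
theorem lsearch_le_of_eq_zero (hK : K ⊨ univTheory k) (g : QSym k (n + 1))
    (s : Language.boundedArith.Term (Empty ⊕ Fin n)) (xs : Fin n → K) {z : K}
    (hzs : z ≤ mLen (s.realize (Sum.elim default xs))) (hz : app g (Fin.snoc xs z) = 0) :
    app (lsearch g s) xs ≤ z := by
  let xv : Fin n → (Language.qsym k).Term (Empty ⊕ Fin (n + 1)) := fun i => qv (Fin.castSucc i)
  let zv : (Language.qsym k).Term (Empty ⊕ Fin (n + 1)) := qv (Fin.last n)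
  let sup : (Language.qsym k).Term (Empty ⊕ Fin (n + 1)) :=
    ιt (Term.len (s.relabel (Sum.map id Fin.castSucc)))
  let gz : (Language.qsym k).Term (Empty ⊕ Fin (n + 1)) := qapp g (Fin.snoc xv zv)
  let lsx : (Language.qsym k).Term (Empty ⊕ Fin (n + 1)) := qapp (lsearch g s) xv
  let Ψ : (Language.qsym k).BoundedFormula Empty (n + 1) :=
    (Term.le zv sup ⊓ Term.bdEqual gz (ιt 0)) ⟹ Term.le lsx zv
  have hΨ : Ψ.IsUniversal :=
    (((IsAtomic.rel _ _).isQF.inf (IsAtomic.equal _ _).isQF).imp (IsAtomic.rel _ _).isQF).isUniversal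
  have hfact := realize_of_fact hK hΨ (fun N _ _ _ hIk u => by
    letI := expansion N k
    haveI : (qsymι k).IsExpansionOn N := isExpansionOn_expansion k
    simp only [Ψ, gz, lsx, xv, zv, sup, realize_imp, realize_inf, realize_bdEqual,
      realize_qle_expansion, Term.realize, funMap_expansion, eval_lsearch,
      Sum.elim_inr, snoc_castSucc_last, Term.realize_relabel, Sum.elim_comp_map,
      LHom.realize_onTerm, realize_term_len, realize_term_zero, mZero_eq]
    rintro ⟨hzs, hz⟩
    have hzs' : u (Fin.last n) ≤ mLen (s.realize (Sum.elim default fun i => u (Fin.castSucc i))) := by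
      simpa [Function.comp_def] using hzs
    have hz' : eval g (Fin.snoc (fun i => u (Fin.castSucc i)) (u (Fin.last n))) = 0 := by
      rw [snoc_castSucc_last]; exact hz
    simpa [Function.comp_def] using lsearchFn_le_of_eq_zero hIk (isQFn_eval hIk g)
      (isTermFn_realize s) hzs' hz') (Fin.snoc xs z)
  simp only [Ψ, gz, lsx, xv, zv, sup, realize_imp, realize_inf, realize_bdEqual, realize_qle,
    Term.realize, realize_snoc_terms, Sum.elim_inr, Fin.snoc_castSucc, Fin.snoc_last, realize_ιt,
    Term.realize_relabel, Sum.elim_comp_map, realize_term_len, realize_term_zero, mZero_eq] at hfact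
  simp only [Function.comp_def, Fin.snoc_castSucc] at hfact
  exact hfact ⟨hzs, hz⟩

/-- **Fact (least zero is a zero).** If `lsearch(x̄) ≤ |s(x̄)|` then `g(x̄, lsearch(x̄)) = 0`.
[folklore] -/
theorem eq_zero_of_lsearch_le (hK : K ⊨ univTheory k) (g : QSym k (n + 1))
    (s : Language.boundedArith.Term (Empty ⊕ Fin n)) (xs : Fin n → K)
    (h : app (lsearch g s) xs ≤ mLen (s.realize (Sum.elim default xs))) :
    app g (Fin.snoc xs (app (lsearch g s) xs)) = 0 := by
  let lsx : (Language.qsym k).Term (Empty ⊕ Fin n) := lsTerm g s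
  let gls : (Language.qsym k).Term (Empty ⊕ Fin n) := qapp g (Fin.snoc (fun i => qv i) lsx)
  let Ψ : (Language.qsym k).BoundedFormula Empty n :=
    Term.le lsx (ιt (Term.len s)) ⟹ Term.bdEqual gls (ιt 0)
  have hΨ : Ψ.IsUniversal := ((IsAtomic.rel _ _).isQF.imp (IsAtomic.equal _ _).isQF).isUniversal
  have hfact := realize_of_fact hK hΨ (fun N _ _ _ hIk u => by
    letI := expansion N k
    haveI : (qsymι k).IsExpansionOn N := isExpansionOn_expansion k
    simp only [Ψ, gls, lsx, realize_imp, realize_bdEqual, realize_qle_expansion, Term.realize,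
      realize_snoc_terms, funMap_expansion, eval_lsearch, Sum.elim_inr, LHom.realize_onTerm,
      realize_term_len, realize_term_zero, mZero_eq]
    exact fun hle => eq_zero_of_lsearchFn_le hIk (isQFn_eval hIk g) (isTermFn_realize s) hle) xs
  simp only [Ψ, gls, lsx, realize_imp, realize_bdEqual, realize_qle, Term.realize,
    realize_snoc_terms, Sum.elim_inr, realize_ιt, realize_term_len, realize_term_zero,
    mZero_eq] at hfact
  exact hfact h

/-- **Fact (χ of a sharply bounded universal).** For `θ = ∀ z ≤ |s|, η` and the
counterexample search `ls = lsearch χ_η s` (least `z ≤ |s|` with `χ_η(x̄, z) = 0`):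
`χ_θ(x̄) = 1 ↔ |s(x̄)| < ls(x̄)`. [folklore] -/
theorem chi_ballLELen_iff (hK : K ⊨ univTheory k) (hχ : IsSigmab (k + 1) η ∨ IsPib (k + 1) η)
    (hθ : IsSigmab (k + 1) (ballLELen s η) ∨ IsPib (k + 1) (ballLELen s η)) (xs : Fin n → K) :
    app (chi (ballLELen s η) hθ) xs = 1 ↔
      mLen (s.realize (Sum.elim default xs)) < app (lsearch (chi η hχ) s) xs := by
  let Ψ : (Language.qsym k).BoundedFormula Empty n :=
    (Term.bdEqual (chiTerm (ballLELen s η) hθ) qone).iff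
      (∼(Term.le (lsTerm (chi η hχ) s) (ιt (Term.len s))))
  have hΨ : Ψ.IsUniversal := by
    have h1 : (Term.bdEqual (chiTerm (ballLELen s η) hθ) qone :
      (Language.qsym k).BoundedFormula Empty n).IsQF := (IsAtomic.equal _ _).isQF
    have h2 : (∼(Term.le (lsTerm (chi η hχ) s) (ιt (Term.len s))) :
      (Language.qsym k).BoundedFormula Empty n).IsQF := (IsAtomic.rel _ _).isQF.not
    exact ((h1.imp h2).inf (h2.imp h1)).isUniversal
  have hfact := realize_of_fact hK hΨ (fun N _ _ _ hIk u => by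
    letI := expansion N k
    haveI : (qsymι k).IsExpansionOn N := isExpansionOn_expansion k
    simp only [Ψ, realize_iff, realize_not, realize_bdEqual, realize_qle_expansion, Term.realize,
      funMap_expansion, eval_chi, eval_lsearch, Sum.elim_inr, LHom.realize_onTerm,
      realize_natConst_one, mSucc_eq, mZero_eq, zero_add, chiFn_eq_one_iff, ballLELen,
      realize_ballLE', realize_term_len, mLe_iff, not_le]
    have hF : IsQFn k (chiFn fun v : Fin (n + 1) → N => η.Realize default v) := by
      rcases hχ with h | h
      · exact isQFn_chiFn h.isSigmabDef_realize
      · exact isQFn_chiFn_of_isPibDef h.isPibDef_realize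
    have hs := isTermFn_realize (M := N) s
    constructor
    · intro hall
      by_contra hle
      push Not at hle
      have h0 := eq_zero_of_lsearchFn_le hIk hF hs hle
      rw [chiFn_eq_zero_iff] at h0
      exact h0 (hall _ hle)
    · intro hlt a ha
      by_contra hna
      have h0 : chiFn (fun v : Fin (n + 1) → N => η.Realize default v) (Fin.snoc u a) = 0 :=
        (chiFn_eq_zero_iff _ _).2 hna
      exact (lsearchFn_le_of_eq_zero hIk hF hs ha h0).not_gt (lt_of_le_of_lt ha hlt)) xs
  simp only [Ψ, realize_iff, realize_not, realize_bdEqual, realize_qle, Term.realize, Sum.elim_inr,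
    realize_ιt, realize_natConst_one, mSucc_eq, mZero_eq, zero_add, realize_term_len, not_le] at hfact
  exact hfact

/-- **Fact (χ of a sharply bounded existential).** For `θ = ∃ z ≤ |s|, η` and the witness
search `ls = lsearch χ_{¬η} s` (least `z ≤ |s|` with `χ_{¬η}(x̄, z) = 0`):
`χ_θ(x̄) = 1 ↔ ls(x̄) ≤ |s(x̄)|`. [folklore] -/
theorem chi_bexLELen_iff (hK : K ⊨ univTheory k) (hχ : IsSigmab (k + 1) (∼η) ∨ IsPib (k + 1) (∼η))
    (hθ : IsSigmab (k + 1) (bexLELen s η) ∨ IsPib (k + 1) (bexLELen s η)) (xs : Fin n → K) :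
    app (chi (bexLELen s η) hθ) xs = 1 ↔
      app (lsearch (chi (∼η) hχ) s) xs ≤ mLen (s.realize (Sum.elim default xs)) := by
  let Ψ : (Language.qsym k).BoundedFormula Empty n :=
    (Term.bdEqual (chiTerm (bexLELen s η) hθ) qone).iff
      (Term.le (lsTerm (chi (∼η) hχ) s) (ιt (Term.len s)))
  have hΨ : Ψ.IsUniversal := by
    have h1 : (Term.bdEqual (chiTerm (bexLELen s η) hθ) qone :
      (Language.qsym k).BoundedFormula Empty n).IsQF := (IsAtomic.equal _ _).isQF
    have h2 : (Term.le (lsTerm (chi (∼η) hχ) s) (ιt (Term.len s)) :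
      (Language.qsym k).BoundedFormula Empty n).IsQF := (IsAtomic.rel _ _).isQF
    exact ((h1.imp h2).inf (h2.imp h1)).isUniversal
  have hfact := realize_of_fact hK hΨ (fun N _ _ _ hIk u => by
    letI := expansion N k
    haveI : (qsymι k).IsExpansionOn N := isExpansionOn_expansion k
    simp only [Ψ, realize_iff, realize_bdEqual, realize_qle_expansion, Term.realize,
      funMap_expansion, eval_chi, eval_lsearch, Sum.elim_inr, LHom.realize_onTerm,
      realize_natConst_one, mSucc_eq, mZero_eq, zero_add, chiFn_eq_one_iff, bexLELen,
      realize_bexLE', realize_term_len, mLe_iff]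
    have hF : IsQFn k (chiFn fun v : Fin (n + 1) → N => (∼η).Realize default v) := by
      rcases hχ with h | h
      · exact isQFn_chiFn h.isSigmabDef_realize
      · exact isQFn_chiFn_of_isPibDef h.isPibDef_realize
    have hs := isTermFn_realize (M := N) s
    constructor
    · rintro ⟨a, ha, hθa⟩
      have h0 : chiFn (fun v : Fin (n + 1) → N => (∼η).Realize default v) (Fin.snoc u a) = 0 :=
        (chiFn_eq_zero_iff _ _).2 (by simpa using hθa)
      exact (lsearchFn_le_of_eq_zero hIk hF hs ha h0).trans ha
    · intro hle
      have h0 := eq_zero_of_lsearchFn_le hIk hF hs hle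
      rw [chiFn_eq_zero_iff] at h0
      exact ⟨_, hle, by simpa using h0⟩) xs
  simp only [Ψ, realize_iff, realize_bdEqual, realize_qle, Term.realize, Sum.elim_inr, realize_ιt,
    realize_natConst_one, mSucc_eq, mZero_eq, zero_add, realize_term_len] at hfact
  exact hfact

end ClassFacts

/-! ## Facts: the values of characteristic functions -/

section ChiValues

variable {n : ℕ} [hKB : K ⊨ BASIC]

/-- **Fact.** A characteristic function takes the values `0` and `1` only. [folklore] -/
theorem chi_eq_zero_or_one (hK : K ⊨ univTheory k) {θ : Language.boundedArith.BoundedFormula Empty n}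
    (h : IsSigmab (k + 1) θ ∨ IsPib (k + 1) θ) (xs : Fin n → K) :
    app (chi θ h) xs = 0 ∨ app (chi θ h) xs = 1 := by
  let Ψ : (Language.qsym k).BoundedFormula Empty n :=
    (Term.bdEqual (chiTerm θ h) (ιt 0)) ⊔ (Term.bdEqual (chiTerm θ h) qone)
  have hΨ : Ψ.IsUniversal := ((IsAtomic.equal _ _).isQF.sup (IsAtomic.equal _ _).isQF).isUniversal
  have hfact := realize_of_fact hK hΨ (fun N _ _ _ hIk u => by
    letI := expansion N k
    haveI : (qsymι k).IsExpansionOn N := isExpansionOn_expansion k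
    simp only [Ψ, realize_sup, realize_bdEqual, Term.realize, funMap_expansion, eval_chi,
      Sum.elim_inr, LHom.realize_onTerm, realize_natConst_one, realize_term_zero, mSucc_eq, mZero_eq,
      zero_add, chiFn_eq_one_iff, chiFn_eq_zero_iff]
    exact em' _) xs
  simp only [Ψ, realize_sup, realize_bdEqual, Term.realize, Sum.elim_inr, realize_ιt,
    realize_natConst_one, realize_term_zero, mSucc_eq, mZero_eq, zero_add] at hfact
  exact hfact

/-- A characteristic function is `≠ 1` iff it is `0`. [folklore] -/
theorem chi_ne_one_iff (hK : K ⊨ univTheory k) {θ : Language.boundedArith.BoundedFormula Empty n}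
    (h : IsSigmab (k + 1) θ ∨ IsPib (k + 1) θ) (xs : Fin n → K) :
    app (chi θ h) xs ≠ 1 ↔ app (chi θ h) xs = 0 := by
  rcases chi_eq_zero_or_one hK h xs with h0 | h1
  · simp [h0]
  · simp [h1]

end ChiValues

/-! ## `θ ↔ χ_θ = 1` for `Σᵇₖ₊₁ ∪ Πᵇₖ₊₁` formulas, in a model of the universal theory -/

section ChiEquiv

variable {n : ℕ} [hKB : K ⊨ BASIC]

/-- Semantics of the sharply bounded universal quantifier in a structure. [folklore] -/
theorem realize_ballLELen' {L' : Type} [Language.boundedArith.Structure L'] {β : Type} {m : ℕ}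
    (s : Language.boundedArith.Term (β ⊕ Fin m)) (φ : Language.boundedArith.BoundedFormula β (m + 1))
    (w : β → L') (xs : Fin m → L') :
    (ballLELen s φ).Realize w xs ↔
      ∀ a, MLe a (mLen (s.realize (Sum.elim w xs))) → φ.Realize w (Fin.snoc xs a) := by
  simp only [ballLELen, realize_ballLE', realize_term_len]

/-- Semantics of the sharply bounded existential quantifier in a structure. [folklore] -/
theorem realize_bexLELen' {L' : Type} [Language.boundedArith.Structure L'] {β : Type} {m : ℕ}
    (s : Language.boundedArith.Term (β ⊕ Fin m)) (φ : Language.boundedArith.BoundedFormula β (m + 1))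
    (w : β → L') (xs : Fin m → L') :
    (bexLELen s φ).Realize w xs ↔
      ∃ a, MLe a (mLen (s.realize (Sum.elim w xs))) ∧ φ.Realize w (Fin.snoc xs a) := by
  simp only [bexLELen, realize_bexLE', realize_term_len]

/-- The statement proved by induction on the class: `θ(x̄) ↔ χ_θ(x̄) = 1` for every admissible
certificate. [folklore] -/
def ChiEquiv (k : ℕ) (K : Type) [Language.boundedArith.Structure K] [(Language.qsym k).Structure K]
    [K ⊨ BASIC] {n : ℕ} (θ : Language.boundedArith.BoundedFormula Empty n) : Prop :=
  ∀ (h : IsSigmab (k + 1) θ ∨ IsPib (k + 1) θ) (xs : Fin n → K), θ.Realize default xs ↔ app (chi θ h) xs = 1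

variable (hK : K ⊨ univTheory k)
include hK

/-- Step: open formulas. [folklore] -/
theorem chiEquiv_of_isQF {θ : Language.boundedArith.BoundedFormula Empty n} (hθ : θ.IsQF) :
    ChiEquiv k K θ := fun h xs => realize_iff_chi_of_isQF hK hθ h xs

/-- Step: implication. [folklore] -/
theorem chiEquiv_imp {φ ψ : Language.boundedArith.BoundedFormula Empty n}
    (hφ : IsSigmab (k + 1) φ ∨ IsPib (k + 1) φ) (hψ : IsSigmab (k + 1) ψ ∨ IsPib (k + 1) ψ)
    (ihφ : ChiEquiv k K φ) (ihψ : ChiEquiv k K ψ) : ChiEquiv k K (φ.imp ψ) := fun hθ xs => by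
  rw [realize_imp, ihφ hφ xs, ihψ hψ xs, chi_imp_iff hK hθ hφ hψ xs]

/-- Step: negation (an implication into `⊥`). [folklore] -/
theorem chiEquiv_not {η : Language.boundedArith.BoundedFormula Empty n}
    (hη : IsSigmab (k + 1) η ∨ IsPib (k + 1) η) (ih : ChiEquiv k K η) : ChiEquiv k K (∼η) :=
  chiEquiv_imp hK hη (Or.inl (.of_isSharplyBounded .falsum)) ih (chiEquiv_of_isQF hK IsQF.falsum)

variable {η : Language.boundedArith.BoundedFormula Empty (n + 1)}
  {t : Language.boundedArith.Term (Empty ⊕ Fin n)} {s : Language.boundedArith.Term (Empty ⊕ Fin n)}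

/-- Step: bounded existential (via the least-witness symbol). [folklore] -/
theorem chiEquiv_bexLE (hη : IsSigmab (k + 1) η) (ih : ChiEquiv k K η) : ChiEquiv k K (bexLE t η) := by
  intro hθ xs
  have hχ : IsSigmab (k + 1) η ∨ IsPib (k + 1) η := Or.inl hη
  rw [realize_bexLE', chi_bexLE_iff hK hη hχ hθ xs]
  constructor
  · rintro ⟨a, ha, hθa⟩
    rw [mLe_iff] at ha
    exact mu_witness hK hη hχ xs ha ((ih hχ _).1 hθa)
  · rintro ⟨h1, h2⟩
    exact ⟨_, (mLe_iff _ _).2 h2, (ih hχ _).2 h1⟩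

/-- Step: bounded universal (via the least-counterexample symbol). [folklore] -/
theorem chiEquiv_ballLE (hη : IsPib (k + 1) η) (ih : ChiEquiv k K η) : ChiEquiv k K (ballLE t η) := by
  intro hθ xs
  have hχ : IsSigmab (k + 1) η ∨ IsPib (k + 1) η := Or.inr hη
  have hnη : IsSigmab (k + 1) (∼η) := hη.not
  have hχn : IsSigmab (k + 1) (∼η) ∨ IsPib (k + 1) (∼η) := Or.inl hnη
  have ihn : ChiEquiv k K (∼η) := chiEquiv_not hK hχ ih
  rw [realize_ballLE', chi_ballLE_iff hK hnη hχn hθ xs]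
  constructor
  · rintro hall ⟨h1, h2⟩
    have := (ihn hχn _).2 h1
    simp only [realize_not] at this
    exact this (hall _ ((mLe_iff _ _).2 h2))
  · intro hno a ha
    rw [mLe_iff] at ha
    by_contra hθa
    have h1 : (∼η).Realize default (Fin.snoc xs a) := by simpa using hθa
    exact hno (mu_witness hK hnη hχn xs ha ((ihn hχn _).1 h1))

/-- Step: sharply bounded universal (via the least-zero symbol of `χ_η`). [folklore] -/
theorem chiEquiv_ballLELen (hχ : IsSigmab (k + 1) η ∨ IsPib (k + 1) η) (ih : ChiEquiv k K η) :
    ChiEquiv k K (ballLELen s η) := by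
  intro hθ xs
  rw [realize_ballLELen', chi_ballLELen_iff hK hχ hθ xs]
  constructor
  · intro hall
    by_contra hle
    push Not at hle
    have h0 := eq_zero_of_lsearch_le hK (chi η hχ) s xs hle
    have h1 : app (chi η hχ) (Fin.snoc xs (app (lsearch (chi η hχ) s) xs)) = 1 :=
      (ih hχ _).1 (hall _ ((mLe_iff _ _).2 hle))
    rw [h0] at h1
    exact zero_ne_one h1
  · intro hlt a ha
    rw [mLe_iff] at ha
    by_contra hθa
    have h0 : app (chi η hχ) (Fin.snoc xs a) = 0 :=
      (chi_ne_one_iff hK hχ _).1 (fun h1 => hθa ((ih hχ _).2 h1))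
    exact (lsearch_le_of_eq_zero hK (chi η hχ) s xs ha h0).not_gt (lt_of_le_of_lt ha hlt)

/-- Step: sharply bounded existential (via the least-zero symbol of `χ_{¬η}`). [folklore] -/
theorem chiEquiv_bexLELen (hχ : IsSigmab (k + 1) η ∨ IsPib (k + 1) η)
    (hχn : IsSigmab (k + 1) (∼η) ∨ IsPib (k + 1) (∼η)) (ih : ChiEquiv k K η) :
    ChiEquiv k K (bexLELen s η) := by
  intro hθ xs
  have ihn : ChiEquiv k K (∼η) := chiEquiv_not hK hχ ih
  rw [realize_bexLELen', chi_bexLELen_iff hK hχn hθ xs]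
  constructor
  · rintro ⟨a, ha, hθa⟩
    rw [mLe_iff] at ha
    have h0 : app (chi (∼η) hχn) (Fin.snoc xs a) = 0 := by
      refine (chi_ne_one_iff hK hχn _).1 fun h1 => ?_
      have := (ihn hχn _).2 h1
      simp only [realize_not] at this
      exact this hθa
    exact (lsearch_le_of_eq_zero hK (chi (∼η) hχn) s xs ha h0).trans ha
  · intro hle
    have h0 := eq_zero_of_lsearch_le hK (chi (∼η) hχn) s xs hle
    refine ⟨_, (mLe_iff _ _).2 hle, ?_⟩
    by_contra hθa
    have h1 : app (chi (∼η) hχn) (Fin.snoc xs (app (lsearch (chi (∼η) hχn) s) xs)) = 1 :=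
      (ihn hχn _).1 (by simpa using hθa)
    rw [h0] at h1
    exact zero_ne_one h1

/-- **Sharply bounded formulas**: `θ(x̄) ↔ χ_θ(x̄) = 1`. [folklore] -/
theorem chiEquiv_of_isSharplyBounded {θ : Language.boundedArith.BoundedFormula Empty n}
    (hθ : IsSharplyBounded θ) : ChiEquiv k K θ := by
  induction hθ with
  | of_isQF h => exact chiEquiv_of_isQF hK h
  | imp h₁ h₂ ih₁ ih₂ =>
    exact chiEquiv_imp hK (Or.inl (.of_isSharplyBounded h₁)) (Or.inl (.of_isSharplyBounded h₂)) ih₁ ih₂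
  | ballLELen s h ih => exact chiEquiv_ballLELen hK (Or.inl (.of_isSharplyBounded h)) ih
  | bexLELen s h ih =>
    exact chiEquiv_bexLELen hK (Or.inl (.of_isSharplyBounded h))
      (Or.inl (.of_isSharplyBounded h.not)) ih

/-- **`Σᵇᵢ` and `Πᵇᵢ` formulas, `i ≤ k + 1`**: `θ(x̄) ↔ χ_θ(x̄) = 1` (simultaneous induction on the
class). [folklore] -/
theorem chiEquiv_of_isSigmab_and_of_isPib (i : ℕ) :
    (∀ {n : ℕ} {θ : Language.boundedArith.BoundedFormula Empty n}, IsSigmab i θ → i ≤ k + 1 →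
      ChiEquiv k K θ) ∧
    (∀ {n : ℕ} {θ : Language.boundedArith.BoundedFormula Empty n}, IsPib i θ → i ≤ k + 1 →
      ChiEquiv k K θ) := by
  constructor
  · intro n θ h
    refine IsSigmab.rec
      (motive_1 := fun i n θ _ => i ≤ k + 1 → ChiEquiv k K θ)
      (motive_2 := fun i n θ _ => i ≤ k + 1 → ChiEquiv k K θ)
      ?_ ?_ ?_ ?_ ?_ ?_ ?_ ?_ ?_ ?_ h
    · exact fun h _ => chiEquiv_of_isSharplyBounded hK h
    · exact fun _ ih hi => ih (Nat.le_of_succ_le hi)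
    · intro i n φ ψ hφ hψ ih₁ ih₂ hi
      exact chiEquiv_imp hK (Or.inr (IsPib.mono_holds hi hφ)) (Or.inl (IsSigmab.mono_holds hi hψ))
        (ih₁ hi) (ih₂ hi)
    · intro i n t η hη ih hi
      exact chiEquiv_bexLE hK (IsSigmab.mono_holds hi hη) (ih hi)
    · intro i n s η hη ih hi
      exact chiEquiv_ballLELen hK (Or.inl (IsSigmab.mono_holds hi hη)) (ih hi)
    · exact fun h _ => chiEquiv_of_isSharplyBounded hK h
    · exact fun _ ih hi => ih (Nat.le_of_succ_le hi)
    · intro i n φ ψ hφ hψ ih₁ ih₂ hi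
      exact chiEquiv_imp hK (Or.inl (IsSigmab.mono_holds hi hφ)) (Or.inr (IsPib.mono_holds hi hψ))
        (ih₁ hi) (ih₂ hi)
    · intro i n t η hη ih hi
      exact chiEquiv_ballLE hK (IsPib.mono_holds hi hη) (ih hi)
    · intro i n s η hη ih hi
      exact chiEquiv_bexLELen hK (Or.inr (IsPib.mono_holds hi hη))
        (Or.inl (IsPib.mono_holds hi hη).not) (ih hi)
  · intro n θ h
    refine IsPib.rec
      (motive_1 := fun i n θ _ => i ≤ k + 1 → ChiEquiv k K θ)
      (motive_2 := fun i n θ _ => i ≤ k + 1 → ChiEquiv k K θ)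
      ?_ ?_ ?_ ?_ ?_ ?_ ?_ ?_ ?_ ?_ h
    · exact fun h _ => chiEquiv_of_isSharplyBounded hK h
    · exact fun _ ih hi => ih (Nat.le_of_succ_le hi)
    · intro i n φ ψ hφ hψ ih₁ ih₂ hi
      exact chiEquiv_imp hK (Or.inr (IsPib.mono_holds hi hφ)) (Or.inl (IsSigmab.mono_holds hi hψ))
        (ih₁ hi) (ih₂ hi)
    · intro i n t η hη ih hi
      exact chiEquiv_bexLE hK (IsSigmab.mono_holds hi hη) (ih hi)
    · intro i n s η hη ih hi
      exact chiEquiv_ballLELen hK (Or.inl (IsSigmab.mono_holds hi hη)) (ih hi)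
    · exact fun h _ => chiEquiv_of_isSharplyBounded hK h
    · exact fun _ ih hi => ih (Nat.le_of_succ_le hi)
    · intro i n φ ψ hφ hψ ih₁ ih₂ hi
      exact chiEquiv_imp hK (Or.inl (IsSigmab.mono_holds hi hφ)) (Or.inr (IsPib.mono_holds hi hψ))
        (ih₁ hi) (ih₂ hi)
    · intro i n t η hη ih hi
      exact chiEquiv_ballLE hK (IsPib.mono_holds hi hη) (ih hi)
    · intro i n s η hη ih hi
      exact chiEquiv_bexLELen hK (Or.inr (IsPib.mono_holds hi hη))
        (Or.inl (IsPib.mono_holds hi hη).not) (ih hi)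

omit hK in
/-- **`θ(x̄) ↔ χ_θ(x̄) = 1` in every model of `univTheory k`**, for every `Σᵇₖ₊₁ ∪ Πᵇₖ₊₁` formula
`θ` (in-context variables, no parameters) and its characteristic-function symbol: the bridge by
which Buss's formulas become open formulas of the universal extension (Krajíček 1995, §5.3:
in `PVᵢ₊₁`, `Σᵇᵢ`-formulas are equivalent to open ones). [cite: Krajicek1995, §5.3] -/
theorem realize_iff_chi_eq_one (hK : K ⊨ univTheory k)
    {θ : Language.boundedArith.BoundedFormula Empty n} (h : IsSigmab (k + 1) θ ∨ IsPib (k + 1) θ)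
    (xs : Fin n → K) : θ.Realize default xs ↔ app (chi θ h) xs = 1 := by
  have h0 := h
  rcases h0 with h' | h'
  · exact (chiEquiv_of_isSigmab_and_of_isPib hK (k + 1)).1 h' le_rfl h xs
  · exact (chiEquiv_of_isSigmab_and_of_isPib hK (k + 1)).2 h' le_rfl h xs

end ChiEquiv

/-! ## Facts: selector, term symbols, truncated subtraction, `MSP`, iterates -/

section ArithFacts

variable [hKB : K ⊨ BASIC]

/-- The selector on values: `selV(a, b, c, d) = (if a ≤ b then c else d)`. [folklore] -/
def selV (k : ℕ) : QSym k 4 := sel (proj 0) (proj 1) (proj 2) (proj 3)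

/-- **Fact (selector).** `a ≤ b → selV(a,b,c,d) = c` and `b < a → selV(a,b,c,d) = d`. [folklore] -/
theorem selV_spec (hK : K ⊨ univTheory k) (w : Fin 4 → K) :
    (w 0 ≤ w 1 → app (selV k) w = w 2) ∧ (w 1 < w 0 → app (selV k) w = w 3) := by
  let sv : (Language.qsym k).Term (Empty ⊕ Fin 4) := qapp (selV k) fun i => qv i
  let Ψ : (Language.qsym k).BoundedFormula Empty 4 :=
    (Term.le (qv 0) (qv 1) ⟹ Term.bdEqual sv (qv 2)) ⊓
      (∼(Term.le (qv 0) (qv 1)) ⟹ Term.bdEqual sv (qv 3))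
  have hΨ : Ψ.IsUniversal :=
    (((IsAtomic.rel _ _).isQF.imp (IsAtomic.equal _ _).isQF).inf
      ((IsAtomic.rel _ _).isQF.not.imp (IsAtomic.equal _ _).isQF)).isUniversal
  have hfact := realize_of_fact hK hΨ (fun N _ _ _ hIk u => by
    letI := expansion N k
    haveI : (qsymι k).IsExpansionOn N := isExpansionOn_expansion k
    simp only [Ψ, sv, selV, realize_inf, realize_imp, realize_not, realize_bdEqual,
      realize_qle_expansion, Term.realize, funMap_expansion, eval_sel, eval_proj, Sum.elim_inr, not_le]
    exact ⟨fun h => selFn_of_le h _ _, fun h => selFn_of_lt h _ _⟩) w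
  simp only [Ψ, sv, realize_inf, realize_imp, realize_not, realize_bdEqual, realize_qle,
    Term.realize, Sum.elim_inr, not_le] at hfact
  exact hfact

omit [Language.boundedArith.Structure K] [(qsymι k).IsExpansionOn K] hKB in
/-- **Fact (term symbols).** `termSym t` denotes the term `t`. [folklore] -/
theorem app_termSym (hK : K ⊨ univTheory k) {m : ℕ} (t : (Language.qsym k).Term (Fin m))
    (v : Fin m → K) : app (termSym t) v = t.realize v := by
  let Ψ : (Language.qsym k).BoundedFormula Empty m :=
    Term.bdEqual (qapp (termSym t) fun i => qv i) (t.relabel Sum.inr)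
  have hΨ : Ψ.IsUniversal := (IsAtomic.equal _ _).isQF.isUniversal
  have hfact := realize_of_fact hK hΨ (fun N _ _ _ hIk u => by
    letI := expansion N k
    simp only [Ψ, realize_bdEqual, Term.realize, funMap_expansion, Sum.elim_inr,
      Term.realize_relabel, Sum.elim_comp_inr, eval_termSym]) v
  simp only [Ψ, realize_bdEqual, Term.realize, Sum.elim_inr, Term.realize_relabel,
    Sum.elim_comp_inr] at hfact
  exact hfact

/-- **Facts (truncated subtraction).** `x ∸ 0 = x`, `x ∸ x = 0`, `j < ℓ → ℓ ∸ j = (ℓ ∸ (j+1)) + 1`,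
`x ≠ 0 → (x ∸ 1) + 1 = x`. [folklore] -/
theorem monus_spec (hK : K ⊨ univTheory k) (w : Fin 2 → K) :
    app (monus (k := k)) ![w 0, 0] = w 0 ∧ app (monus (k := k)) ![w 0, w 0] = 0 ∧
      (w 1 < w 0 → app (monus (k := k)) ![w 0, w 1] = app (monus (k := k)) ![w 0, w 1 + 1] + 1) ∧
      (w 0 ≠ 0 → app (monus (k := k)) ![w 0, 1] + 1 = w 0) := by
  let x : (Language.qsym k).Term (Empty ⊕ Fin 2) := qv 0
  let j : (Language.qsym k).Term (Empty ⊕ Fin 2) := qv 1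
  let z : (Language.qsym k).Term (Empty ⊕ Fin 2) := ιt 0
  let mo : (Language.qsym k).Term (Empty ⊕ Fin 2) → (Language.qsym k).Term (Empty ⊕ Fin 2) →
      (Language.qsym k).Term (Empty ⊕ Fin 2) := fun a b => Functions.apply₂ (monus : QSym k 2) a b
  let sc : (Language.qsym k).Term (Empty ⊕ Fin 2) → (Language.qsym k).Term (Empty ⊕ Fin 2) :=
    fun a => Functions.apply₁ (QSym.ba BoundedArithFunc.succ : QSym k 1) a
  let Ψ : (Language.qsym k).BoundedFormula Empty 2 :=
    Term.bdEqual (mo x z) x ⊓ Term.bdEqual (mo x x) z ⊓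
      (∼(Term.le x j) ⟹ Term.bdEqual (mo x j) (sc (mo x (sc j)))) ⊓
      (∼(Term.bdEqual x z) ⟹ Term.bdEqual (sc (mo x qone)) x)
  have hΨ : Ψ.IsUniversal :=
    ((((IsAtomic.equal _ _).isQF.inf (IsAtomic.equal _ _).isQF).inf
      ((IsAtomic.rel _ _).isQF.not.imp (IsAtomic.equal _ _).isQF)).inf
      ((IsAtomic.equal _ _).isQF.not.imp (IsAtomic.equal _ _).isQF)).isUniversal
  have hsuccK : ∀ a : K, Structure.funMap (L := Language.qsym k) (QSym.ba BoundedArithFunc.succ) ![a]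
      = a + 1 := by
    intro a
    have h := LHom.map_onFunction (ϕ := qsymι k) (M := K) BoundedArithFunc.succ ![a]
    exact h.trans (mSucc_eq a)
  have hfact := realize_of_fact hK hΨ (fun N _ _ _ hIk u => by
    letI := expansion N k
    haveI : (qsymι k).IsExpansionOn N := isExpansionOn_expansion k
    have hsuccN : ∀ a : N, eval (k := k) (QSym.ba BoundedArithFunc.succ) ![a] = a + 1 := fun a => by
      rw [eval_ba]; exact mSucc_eq a
    simp only [Ψ, mo, sc, x, j, z, realize_inf, realize_imp, realize_not, realize_bdEqual,
      realize_qle_expansion, Term.realize, Term.realize_functions_apply₁,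
      Term.realize_functions_apply₂, funMap_expansion, eval_monus, Sum.elim_inr,
      LHom.realize_onTerm, realize_term_zero, realize_natConst_one, mSucc_eq, mZero_eq, zero_add,
      not_le, Matrix.cons_val_zero, Matrix.cons_val_one, hsuccN]
    refine ⟨⟨⟨tsub_zero _, tsub_self _⟩, fun hlt => ?_⟩, fun hne => ?_⟩
    · rw [← tsub_tsub, tsub_add_cancel_of_le (one_le_of_lt (tsub_pos_of_lt hlt))]
    · exact tsub_add_cancel_of_le ((one_le_iff_ne_zero' _).2 hne)) w
  simp only [Ψ, mo, sc, x, j, z, realize_inf, realize_imp, realize_not, realize_bdEqual, realize_qle,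
    Term.realize, Term.realize_functions_apply₁, Term.realize_functions_apply₂, Sum.elim_inr,
    realize_ιt, realize_term_zero, realize_natConst_one, mSucc_eq, mZero_eq, zero_add, not_le,
    hsuccK] at hfact
  obtain ⟨⟨⟨h1, h2⟩, h3⟩, h4⟩ := hfact
  exact ⟨h1, h2, h3, h4⟩

omit hKB in
/-- In `K`, Buss's symbols inside `Language.qsym k` are interpreted as in the reduct. [folklore] -/
@[simp] theorem funMap_ba {m : ℕ} (f : BoundedArithFunc m) (v : Fin m → K) :
    Structure.funMap (L := Language.qsym k) (QSym.ba f) v =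
      Structure.funMap (L := Language.boundedArith) f v :=
  LHom.map_onFunction (ϕ := qsymι k) (M := K) f v

/-- **Facts (`MSP`).** `MSP(b, |b|) = 0`, `MSP(b, 0) = b`, `MSP(b, i+1) = ⌊MSP(b, i)/2⌋`.
[cite: Buss1986, §2.4] -/
theorem msp_spec (hK : K ⊨ univTheory k) (w : Fin 2 → K) :
    app (msp (k := k)) ![w 0, mLen (w 0)] = 0 ∧ app (msp (k := k)) ![w 0, 0] = w 0 ∧
      app (msp (k := k)) ![w 0, w 1 + 1] = mHalf (app (msp (k := k)) ![w 0, w 1]) := by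
  let b : (Language.qsym k).Term (Empty ⊕ Fin 2) := qv 0
  let i : (Language.qsym k).Term (Empty ⊕ Fin 2) := qv 1
  let z : (Language.qsym k).Term (Empty ⊕ Fin 2) := ιt 0
  let ms : (Language.qsym k).Term (Empty ⊕ Fin 2) → (Language.qsym k).Term (Empty ⊕ Fin 2) →
      (Language.qsym k).Term (Empty ⊕ Fin 2) := fun a c => Functions.apply₂ (msp : QSym k 2) a c
  let ba1 : BoundedArithFunc 1 → (Language.qsym k).Term (Empty ⊕ Fin 2) →
      (Language.qsym k).Term (Empty ⊕ Fin 2) := fun f a => Functions.apply₁ (QSym.ba f : QSym k 1) a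
  let Ψ : (Language.qsym k).BoundedFormula Empty 2 :=
    Term.bdEqual (ms b (ba1 .len b)) z ⊓ Term.bdEqual (ms b z) b ⊓
      Term.bdEqual (ms b (ba1 .succ i)) (ba1 .half (ms b i))
  have hΨ : Ψ.IsUniversal :=
    (((IsAtomic.equal _ _).isQF.inf (IsAtomic.equal _ _).isQF).inf (IsAtomic.equal _ _).isQF).isUniversal
  have hfact := realize_of_fact hK hΨ (fun N _ _ _ hIk u => by
    letI := expansion N k
    haveI : (qsymι k).IsExpansionOn N := isExpansionOn_expansion k
    have hba : ∀ (f : BoundedArithFunc 1) (a : N), eval (k := k) (QSym.ba f) ![a] =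
        Structure.funMap (L := Language.boundedArith) f ![a] := fun f a => eval_ba f _
    simp only [Ψ, ms, ba1, b, i, z, realize_inf, realize_bdEqual, Term.realize,
      Term.realize_functions_apply₁, Term.realize_functions_apply₂, funMap_expansion, eval_msp,
      Sum.elim_inr, LHom.realize_onTerm, realize_term_zero, mZero_eq, Matrix.cons_val_zero,
      Matrix.cons_val_one, hba]
    change (mspFn (u 0) (mLen (u 0)) = 0 ∧ mspFn (u 0) 0 = u 0) ∧
      mspFn (u 0) (mSucc (u 1)) = mHalf (mspFn (u 0) (u 1))
    refine ⟨⟨(div_eq_zero_iff' (pow2B_pos _ _)).2 (lt_pow2B_mLen _), by simp [mspFn]⟩, ?_⟩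
    rw [mSucc_eq, ← div_two_eq_mHalf, mspFn, mspFn, div_div']
    rcases lt_or_ge (u 1) (mLen (u 0)) with h | h
    · rw [pow2B_add_one h, mul_comm]
    · rw [pow2B_of_mLen_le (h.trans (le_add_right'' _ _)), pow2B_of_mLen_le h,
        (div_eq_zero_iff' (pow2B_pos _ _)).2 (lt_pow2B_mLen _),
        (div_eq_zero_iff' (mul_pos (pow2B_pos _ _) two_pos')).2
          ((lt_pow2B_mLen _).trans_le (le_mul_of_one_le_right' ?_))]
      exact one_le_two') w
  simp only [Ψ, ms, ba1, b, i, z, realize_inf, realize_bdEqual, Term.realize,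
    Term.realize_functions_apply₁, Term.realize_functions_apply₂, Sum.elim_inr, realize_ιt,
    realize_term_zero, mZero_eq, funMap_ba] at hfact
  obtain ⟨⟨h1, h2⟩, h3⟩ := hfact
  exact ⟨h1, h2, (congrArg (fun c => app msp ![w 0, c]) (mSucc_eq (w 1)).symm).trans h3⟩

variable {m : ℕ}

/-- **Fact (iterates, base).** `itv(x̄, u₀, 0) = u₀`. [cite: BussContempMath1990, Thm. 11(b)] -/
theorem itv_zero (hK : K ⊨ univTheory k) (G : QSym k (m + 2))
    (R s : Language.boundedArith.Term (Empty ⊕ Fin m)) (xs : Fin (m + 1) → K) :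
    app (itv G R s) (Fin.snoc xs 0) = xs (Fin.last m) := by
  let Ψ : (Language.qsym k).BoundedFormula Empty (m + 1) :=
    Term.bdEqual (qapp (itv G R s) (Fin.snoc (fun i => qv i) (ιt 0))) (qv (Fin.last m))
  have hΨ : Ψ.IsUniversal := (IsAtomic.equal _ _).isQF.isUniversal
  have hfact := realize_of_fact hK hΨ (fun N _ _ _ hIk u => by
    letI := expansion N k
    haveI : (qsymι k).IsExpansionOn N := isExpansionOn_expansion k
    simp only [Ψ, realize_bdEqual, Term.realize, realize_snoc_terms, funMap_expansion, eval_itv,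
      Sum.elim_inr, LHom.realize_onTerm, realize_term_zero, mZero_eq]
    have h := seqEl_histFn_zero hIk (isQFn_eval hIk G) (isTermFn_realize (M := N) R)
      (isTermFn_realize (M := N) s) u
    simpa [itvFn, Fin.init_snoc] using h) xs
  simp only [Ψ, realize_bdEqual, Term.realize, realize_snoc_terms, Sum.elim_inr, realize_ιt,
    realize_term_zero, mZero_eq] at hfact
  exact hfact

/-- **Fact (iterates, step).** For `j < |s(x̄)|`, if `G(x̄, j, itv(x̄,u₀,j)) ≤ R(x̄)` then
`itv(x̄, u₀, j+1) = G(x̄, j, itv(x̄,u₀,j))`. [cite: BussContempMath1990, Thm. 11(b)] -/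
theorem itv_succ (hK : K ⊨ univTheory k) (G : QSym k (m + 2))
    (R s : Language.boundedArith.Term (Empty ⊕ Fin m)) (x : Fin m → K) (u₀ j : K)
    (hj : j < mLen (s.realize (Sum.elim default x)))
    (hG : app G (Fin.snoc (Fin.snoc x j) (app (itv G R s) (Fin.snoc (Fin.snoc x u₀) j))) ≤
      R.realize (Sum.elim default x)) :
    app (itv G R s) (Fin.snoc (Fin.snoc x u₀) (j + 1)) =
      app G (Fin.snoc (Fin.snoc x j) (app (itv G R s) (Fin.snoc (Fin.snoc x u₀) j))) := by
  -- context `(x̄, u₀, j)`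
  let xv : Fin m → (Language.qsym k).Term (Empty ⊕ Fin (m + 2)) :=
    fun i => qv (Fin.castSucc (Fin.castSucc i))
  let uv : (Language.qsym k).Term (Empty ⊕ Fin (m + 2)) := qv (Fin.last m).castSucc
  let jv : (Language.qsym k).Term (Empty ⊕ Fin (m + 2)) := qv (Fin.last (m + 1))
  let sc : (Language.qsym k).Term (Empty ⊕ Fin (m + 2)) → (Language.qsym k).Term (Empty ⊕ Fin (m + 2)) :=
    fun a => Functions.apply₁ (QSym.ba BoundedArithFunc.succ : QSym k 1) a
  let itvT : (Language.qsym k).Term (Empty ⊕ Fin (m + 2)) → (Language.qsym k).Term (Empty ⊕ Fin (m + 2)) :=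
    fun a => qapp (itv G R s) (Fin.snoc (Fin.snoc xv uv) a)
  let Gt : (Language.qsym k).Term (Empty ⊕ Fin (m + 2)) := qapp G (Fin.snoc (Fin.snoc xv jv) (itvT jv))
  let lift : Language.boundedArith.Term (Empty ⊕ Fin m) → (Language.qsym k).Term (Empty ⊕ Fin (m + 2)) :=
    fun t => ιt (t.relabel (Sum.map id (Fin.castSucc ∘ Fin.castSucc)))
  let Ψ : (Language.qsym k).BoundedFormula Empty (m + 2) :=
    (∼(Term.le (ιt (Term.len (s.relabel (Sum.map id (Fin.castSucc ∘ Fin.castSucc))))) jv) ⊓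
      Term.le Gt (lift R)) ⟹ Term.bdEqual (itvT (sc jv)) Gt
  have hΨ : Ψ.IsUniversal :=
    (((IsAtomic.rel _ _).isQF.not.inf (IsAtomic.rel _ _).isQF).imp (IsAtomic.equal _ _).isQF).isUniversal
  have hfact := realize_of_fact hK hΨ (fun N _ _ _ hIk u => by
    letI := expansion N k
    haveI : (qsymι k).IsExpansionOn N := isExpansionOn_expansion k
    have hsuccN : ∀ a : N, eval (k := k) (QSym.ba BoundedArithFunc.succ) ![a] = a + 1 := fun a => by
      rw [eval_ba]; exact mSucc_eq a
    simp only [Ψ, Gt, itvT, lift, sc, xv, uv, jv, realize_imp, realize_inf, realize_not, realize_bdEqual,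
      realize_qle_expansion, Term.realize, Term.realize_functions_apply₁, realize_snoc_terms,
      funMap_expansion, eval_itv, Sum.elim_inr, LHom.realize_onTerm, realize_term_len,
      Term.realize_relabel, Sum.elim_comp_map, not_le, hsuccN]
    rintro ⟨hj, hG⟩
    set x : Fin m → N := fun i => u (Fin.castSucc (Fin.castSucc i)) with hx
    have hj' : u (Fin.last (m + 1)) < histLen (fun y => s.realize (Sum.elim default y))
        (Fin.snoc x (u (Fin.last m).castSucc)) := by
      simpa [histLen, Fin.init_snoc, Function.comp_def] using hj
    have h := seqEl_histFn_succ hIk (isQFn_eval hIk G) (isTermFn_realize (M := N) R)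
      (isTermFn_realize (M := N) s) (Fin.snoc x (u (Fin.last m).castSucc)) hj'
    simp only [itvFn, Fin.init_snoc, Fin.snoc_last] at hG ⊢
    rw [h, Fin.init_snoc]
    refine min_eq_left ?_
    simpa [Function.comp_def] using hG) (Fin.snoc (Fin.snoc x u₀) j)
  simp only [Ψ, Gt, itvT, lift, sc, xv, uv, jv, realize_imp, realize_inf, realize_not, realize_bdEqual,
    realize_qle, Term.realize, Term.realize_functions_apply₁, realize_snoc_terms, Sum.elim_inr,
    realize_ιt, realize_term_len, Term.realize_relabel, Sum.elim_comp_map, Function.comp_id,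
    snoc_snoc_comp_castSucc_castSucc, not_le, funMap_ba, Fin.snoc_castSucc, Fin.snoc_last] at hfact
  have e : (fun i => x i) = x := rfl
  simp only [e] at hfact
  have hs1 : Structure.funMap (L := Language.boundedArith) BoundedArithFunc.succ ![j] = j + 1 :=
    mSucc_eq j
  rw [hs1] at hfact
  exact hfact ⟨hj, hG⟩

/-- **Fact.** `MSP(b, i) ≤ b`. [folklore] -/
theorem msp_le (hK : K ⊨ univTheory k) (b i : K) : app (msp (k := k)) ![b, i] ≤ b := by
  let Ψ : (Language.qsym k).BoundedFormula Empty 2 :=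
    Term.le (Functions.apply₂ (msp : QSym k 2) (qv 0) (qv 1)) (qv 0)
  have hΨ : Ψ.IsUniversal := (IsAtomic.rel _ _).isQF.isUniversal
  have hfact := realize_of_fact hK hΨ (fun N _ _ _ hIk u => by
    letI := expansion N k
    simp only [Ψ, realize_qle_expansion, Term.realize, Term.realize_functions_apply₂,
      funMap_expansion, eval_msp, Sum.elim_inr, Matrix.cons_val_zero, Matrix.cons_val_one]
    exact div_le_self' _ _) ![b, i]
  simp only [Ψ, realize_qle, Term.realize, Term.realize_functions_apply₂, Sum.elim_inr,
    Matrix.cons_val_zero, Matrix.cons_val_one] at hfact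
  exact hfact

/-- The length bound `S' = (2s+1) # (2(u₀+R)+1)` of the code of an iteration, as a term (given
terms for `s`, `R` and `u₀`). [folklore] -/
def histSTerm {α : Type} (sl Rl u : (Language.qsym k).Term α) : (Language.qsym k).Term α :=
  Functions.apply₂ (QSym.ba BoundedArithFunc.smash : QSym k 2)
    (Functions.apply₂ (QSym.ba BoundedArithFunc.add : QSym k 2)
      (Functions.apply₂ (QSym.ba BoundedArithFunc.add : QSym k 2) sl sl) qone)
    (Functions.apply₂ (QSym.ba BoundedArithFunc.add : QSym k 2)
      (Functions.apply₂ (QSym.ba BoundedArithFunc.add : QSym k 2)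
        (Functions.apply₂ (QSym.ba BoundedArithFunc.add : QSym k 2) u Rl)
        (Functions.apply₂ (QSym.ba BoundedArithFunc.add : QSym k 2) u Rl)) qone)

/-- The digit width `|u₀ + R|` as a term. [folklore] -/
def histWTerm {α : Type} (Rl u : (Language.qsym k).Term α) : (Language.qsym k).Term α :=
  Functions.apply₁ (QSym.ba BoundedArithFunc.len : QSym k 1)
    (Functions.apply₂ (QSym.ba BoundedArithFunc.add : QSym k 2) u Rl)

/-- **Fact (decoding the code of an iteration).** Digit `j` of `hist g R s (x̄, u₀)` (width
`|u₀ + R(x̄)|`, length bound `(2 s(x̄) + 1) # (2 (u₀ + R(x̄)) + 1)`) is the iterate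
`itv g R s (x̄, u₀, j)`. [cite: BussContempMath1990, Thm. 11(b)] -/
theorem seqel_hist (hK : K ⊨ univTheory k) (G : QSym k (m + 2))
    (R s : Language.boundedArith.Term (Empty ⊕ Fin m)) (x : Fin m → K) (u₀ j : K) :
    app (seqel (k := k)) ![mSmash (s.realize (Sum.elim default x) + s.realize (Sum.elim default x) + 1)
        (u₀ + R.realize (Sum.elim default x) + (u₀ + R.realize (Sum.elim default x)) + 1),
      mLen (u₀ + R.realize (Sum.elim default x)), app (hist G R s) (Fin.snoc x u₀), j] =
      app (itv G R s) (Fin.snoc (Fin.snoc x u₀) j) := by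
  let xv : Fin m → (Language.qsym k).Term (Empty ⊕ Fin (m + 2)) :=
    fun i => qv (Fin.castSucc (Fin.castSucc i))
  let uv : (Language.qsym k).Term (Empty ⊕ Fin (m + 2)) := qv (Fin.last m).castSucc
  let jv : (Language.qsym k).Term (Empty ⊕ Fin (m + 2)) := qv (Fin.last (m + 1))
  let lift : Language.boundedArith.Term (Empty ⊕ Fin m) → (Language.qsym k).Term (Empty ⊕ Fin (m + 2)) :=
    fun t => ιt (t.relabel (Sum.map id (Fin.castSucc ∘ Fin.castSucc)))
  let H : (Language.qsym k).Term (Empty ⊕ Fin (m + 2)) := qapp (hist G R s) (Fin.snoc xv uv)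
  let lhs : (Language.qsym k).Term (Empty ⊕ Fin (m + 2)) :=
    Term.func (seqel : QSym k 4) ![histSTerm (lift s) (lift R) uv, histWTerm (lift R) uv, H, jv]
  let rhs : (Language.qsym k).Term (Empty ⊕ Fin (m + 2)) := qapp (itv G R s) (Fin.snoc (Fin.snoc xv uv) jv)
  let Ψ : (Language.qsym k).BoundedFormula Empty (m + 2) := Term.bdEqual lhs rhs
  have hΨ : Ψ.IsUniversal := (IsAtomic.equal _ _).isQF.isUniversal
  have hfact := realize_of_fact hK hΨ (fun N _ _ _ hIk u => by
    letI := expansion N k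
    haveI : (qsymι k).IsExpansionOn N := isExpansionOn_expansion k
    have hba1 : ∀ (f : BoundedArithFunc 1) (a : N), eval (k := k) (QSym.ba f) ![a] =
        Structure.funMap (L := Language.boundedArith) f ![a] := fun f a => eval_ba f _
    have hba2 : ∀ (f : BoundedArithFunc 2) (a b : N), eval (k := k) (QSym.ba f) ![a, b] =
        Structure.funMap (L := Language.boundedArith) f ![a, b] := fun f a b => eval_ba f _
    simp only [Ψ, lhs, rhs, H, realize_bdEqual, realize_func_vec4]
    simp only [histSTerm, histWTerm, lift, xv, uv, jv, Term.realize,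
      Term.realize_functions_apply₁, Term.realize_functions_apply₂, realize_snoc_terms,
      funMap_expansion, eval_seqel, eval_hist, eval_itv, Sum.elim_inr,
      LHom.realize_onTerm, Term.realize_relabel, Sum.elim_comp_map, Function.comp_id,
      Matrix.cons_val_zero, Matrix.cons_val_one, Matrix.cons_val,
      realize_natConst_one, mSucc_eq, mZero_eq, zero_add, hba1, hba2]
    simp only [itvFn, itBound, itWidth, histR, histS, Fin.init_snoc, Fin.snoc_last]
    change seqEl (mSmash (mAdd (mAdd _ _) 1) (mAdd (mAdd (mAdd _ _) (mAdd _ _)) 1)) (mLen (mAdd _ _)) _ _ = _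
    simp only [mAdd_eq, two_mul]
    rfl) (Fin.snoc (Fin.snoc x u₀) j)
  simp only [Ψ, lhs, rhs, H, realize_bdEqual, realize_func_vec4] at hfact
  simp only [histSTerm, histWTerm, lift, xv, uv, jv, Term.realize,
    Term.realize_functions_apply₁, Term.realize_functions_apply₂, realize_snoc_terms,
    Sum.elim_inr, realize_ιt, Term.realize_relabel, Sum.elim_comp_map,
    Function.comp_id, snoc_snoc_comp_castSucc_castSucc, funMap_ba, Fin.snoc_castSucc,
    Fin.snoc_last, realize_natConst_one, mSucc_eq, mZero_eq, zero_add] at hfact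
  have e : (fun i => x i) = x := rfl
  simp only [e] at hfact
  exact hfact

/-- **Fact (size of the code of an iteration).** `hist g R s (x̄, u₀) ≤ 2 S' + 1` with
`S' = (2 s(x̄) + 1) # (2 (u₀ + R(x̄)) + 1)`. [folklore] -/
theorem hist_le (hK : K ⊨ univTheory k) (G : QSym k (m + 2))
    (R s : Language.boundedArith.Term (Empty ⊕ Fin m)) (x : Fin m → K) (u₀ : K) :
    app (hist G R s) (Fin.snoc x u₀) ≤
      mSmash (s.realize (Sum.elim default x) + s.realize (Sum.elim default x) + 1)
        (u₀ + R.realize (Sum.elim default x) + (u₀ + R.realize (Sum.elim default x)) + 1) +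
      mSmash (s.realize (Sum.elim default x) + s.realize (Sum.elim default x) + 1)
        (u₀ + R.realize (Sum.elim default x) + (u₀ + R.realize (Sum.elim default x)) + 1) + 1 := by
  let xv : Fin m → (Language.qsym k).Term (Empty ⊕ Fin (m + 1)) := fun i => qv (Fin.castSucc i)
  let uv : (Language.qsym k).Term (Empty ⊕ Fin (m + 1)) := qv (Fin.last m)
  let lift : Language.boundedArith.Term (Empty ⊕ Fin m) → (Language.qsym k).Term (Empty ⊕ Fin (m + 1)) :=
    fun t => ιt (t.relabel (Sum.map id Fin.castSucc))
  let H : (Language.qsym k).Term (Empty ⊕ Fin (m + 1)) := qapp (hist G R s) fun i => qv i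
  let S' : (Language.qsym k).Term (Empty ⊕ Fin (m + 1)) := histSTerm (lift s) (lift R) uv
  let Ψ : (Language.qsym k).BoundedFormula Empty (m + 1) :=
    Term.le H (Functions.apply₂ (QSym.ba BoundedArithFunc.add : QSym k 2)
      (Functions.apply₂ (QSym.ba BoundedArithFunc.add : QSym k 2) S' S') qone)
  have hΨ : Ψ.IsUniversal := (IsAtomic.rel _ _).isQF.isUniversal
  have hfact := realize_of_fact hK hΨ (fun N _ _ _ hIk u => by
    letI := expansion N k
    haveI : (qsymι k).IsExpansionOn N := isExpansionOn_expansion k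
    have hba1 : ∀ (f : BoundedArithFunc 1) (a : N), eval (k := k) (QSym.ba f) ![a] =
        Structure.funMap (L := Language.boundedArith) f ![a] := fun f a => eval_ba f _
    have hba2 : ∀ (f : BoundedArithFunc 2) (a b : N), eval (k := k) (QSym.ba f) ![a, b] =
        Structure.funMap (L := Language.boundedArith) f ![a, b] := fun f a b => eval_ba f _
    simp only [Ψ, H, S', histSTerm, lift, uv, realize_qle_expansion, Term.realize,
      Term.realize_functions_apply₂, funMap_expansion, eval_hist,
      Sum.elim_inr, LHom.realize_onTerm, Term.realize_relabel, Sum.elim_comp_map, Function.comp_id,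
      hba2]
    simp only [realize_natConst_one, mSucc_eq, mZero_eq, zero_add]
    change histFn _ _ _ _ ≤ mAdd (mAdd (mSmash (mAdd (mAdd _ _) 1) (mAdd (mAdd (mAdd _ _) (mAdd _ _)) 1))
      (mSmash (mAdd (mAdd _ _) 1) (mAdd (mAdd (mAdd _ _) (mAdd _ _)) 1))) 1
    simp only [mAdd_eq]
    have h := histFn_lt hIk (isQFn_eval hIk G) (isTermFn_realize (M := N) R)
      (isTermFn_realize (M := N) s) u
    refine (h.le.trans (pow2B_le _ _)).trans (le_of_eq ?_)
    simp only [itBound, histR, histS, two_mul]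
    rfl) (Fin.snoc x u₀)
  simp only [Ψ, H, S', histSTerm, lift, uv, realize_qle, Term.realize,
    Term.realize_functions_apply₂, Sum.elim_inr, realize_ιt,
    Term.realize_relabel, Sum.elim_comp_map, Function.comp_id, Fin.snoc_comp_castSucc, funMap_ba,
    Fin.snoc_last] at hfact
  simp only [realize_natConst_one, mSucc_eq, mZero_eq, zero_add] at hfact
  exact hfact

end ArithFacts

end QSym

end Literature.Computability.MetaComplexity
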